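import Mathlib
import HarnessLib
import Literature.AlgebraicGeometry.Resolution.Blowups
import Literature.AlgebraicGeometry.Resolution.MarkedIdeals
import Literature.AlgebraicGeometry.Resolution.BlowupSequences
import Literature.AlgebraicGeometry.Resolution.ResolutionOfSingularities
import Literature.AlgebraicGeometry.Resolution.KollarBlowupSequenceFunctors

/-!
# MaxOrderAtomClasses — the MAX-ORDER ATOMS of the sandwich residual (phase 1 of «MaxOrderAtoms»)

ROUTE-INDEPENDENT definitions module (Literature imports only) for the decomp-res node MaxOrderAtoms /
CompanionReduction (lens-3 g7; source HOME/decomp-res-lens-3/g7/MaxOrderAtoms.lean sha256 91036a4fcfe2fdc9, 782 lines;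
CRITIC-LEDGER row 46 2026-08-30T07:24Z: CLEARED AS MAP + PORT-SHARPENING NODE, critic's `lean check` rc 0 · 0 err ·
0 warn · 0 sorry · `closes_atoms` axioms standard).  It hosts the PARAMETRISED notions the route asides
`Dominance.BlowupResolve` / `Dominance.MaxOrderStepsTame` / `Dominance.MaxOrderStepsWild` /
`Dominance.BlowupResolveDimFour` (Part A: MR^{proper} 24574 as max-order atoms, Cutkosky's induction on the maximal
order) and `MaxContactCut.MaxOrderThreefoldResolution` / `MaxContactCut.CompanionReduction` (Part B: the tame seam X1
28616 split by Włodarczyk's companion-ideal reduction) are stated over: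

* `UpTo k m` — PR_all^{≤ m} over `k`: blow-ups of regular integral `k`-varieties along nonzero ideal sheaves of order
  `≤ m` everywhere admit a resolution; `UpToDimFour k m` — the same in ambient dimension `≤ 4`;
* `MaxOrderStep r` (the atom at order `r`: `UpTo k (r-1) → UpTo k r`, every prime), its TAME slice
  `MaxOrderStepTame r` (`r < p`) and WILD slice `MaxOrderStepWild r` (`p ≤ r`); the dimension-4 slices
  `MaxOrderStepTameDimFour r`, `MaxOrderStepWildDimFour r`; the rung `BlowupResolveLE m`;
* `MaxOrderThreefoldResolutionAt c` (MaxOrd₃^E(c): max-order marked ideals `(J, E, c)` WITH snc boundary on regular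
  threefolds resolve) and its boundary-free slice `MaxOrderThreefoldResolutionEmptyAt c`.

Dictionary [Wlodarczyk2005 §4; Cutkosky2009 Thm. 1.3/5.1; BierstoneGrigorievMilmanWlodarczyk2011 Def. 3.1.3]: marked
ideal `(X,I,E,μ)` ↦ tree `MarkedIdeal X := ⟨I, E, μ⟩`; resolution ↦ `CentreSeq.IsResolutionOf`; «simple basic object /
max-order marked ideal» ↦ the hypothesis `∀ y, idealOrder I y ≤ μ`.  No statement here is a claim: these are
definitions; the kernels live in `Theorems.DominanceMaxOrderAtoms` and `Theorems.MaxContactCutCompanionReduction`.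
-/

namespace Summit.ResolutionOfSingularities.ResolutionOfSingularities.Theorems.MaxOrderAtomClasses

open CategoryTheory AlgebraicGeometry
open Literature.AlgebraicGeometry.Resolution

/-! ## Part A notions — blow-ups of bounded maximal order (sandwich currency, all dimensions) -/

/-- **PR_all^{≤ m} over the field `k`** — every blow-up of a regular integral variety `Y/k` (separated, of
finite type) along a nonzero ideal sheaf of order `≤ m` at every point admits a resolution.
(Cutkosky2009, Thm. 1.3) -/
def UpTo (k : Type) [Field k] (m : ℕ) : Prop :=
  ∀ (Y : Scheme.{0}) (g : Y ⟶ Spec (.of k)), IsSeparated g → LocallyOfFiniteType g → QuasiCompact g →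
    IsIntegral Y → Scheme.IsRegular Y →
    ∀ I : Y.IdealSheafData, I ≠ ⊥ → (∀ y : Y, idealOrder I y ≤ m) →
      ∀ (Γ : Scheme.{0}) (b : Γ ⟶ Y), IsBlowup b I → Scheme.HasResolution Γ

/-- The rung **BlowupResolveLE m** of Cutkosky's ladder: blow-ups of nonzero ideals of maximal order `≤ m` on regular
varieties resolve, every prime `p` (`m = 0` is proved in the kernels file). (Cutkosky2009, Thm. 1.3) -/
def BlowupResolveLE (m : ℕ) : Prop :=
  ∀ p : ℕ, p.Prime → ∀ (k : Type) [Field k] [CharP k p], UpTo k m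

/-- The **MAX-ORDER ATOM at order `r`** (Cutkosky 2009 Thm. 5.1 one dimension up, sandwich currency): given
PR_all^{≤ r−1} over `k`, blow-ups of ideals of maximal order `≤ r` resolve. (Cutkosky2009, Thm. 5.1) -/
def MaxOrderStep (r : ℕ) : Prop :=
  ∀ p : ℕ, p.Prime → ∀ (k : Type) [Field k] [CharP k p], UpTo k (r - 1) → UpTo k r

/-- The **TAME slice** of the atom (`r < p = char k`: hypersurfaces of maximal contact exist, Włodarczyk 2005 Lemma 3
is characteristic-free for `ord < p`). (Wlodarczyk2005, §4 Step 1) -/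
def MaxOrderStepTame (r : ℕ) : Prop :=
  ∀ p : ℕ, p.Prime → ∀ (k : Type) [Field k] [CharP k p], r < p → UpTo k (r - 1) → UpTo k r

/-- The **WILD slice** of the atom (`p ≤ r`; contains at `r = p`, contact-free points, the hyperplanar core 28544 in
all-ideal format; no lever in print). (CossartPiltant2019, Introduction) (Hauser2010, §1) -/
def MaxOrderStepWild (r : ℕ) : Prop :=
  ∀ p : ℕ, p.Prime → ∀ (k : Type) [Field k] [CharP k p], p ≤ r → UpTo k (r - 1) → UpTo k r

/-! ## Part A′ notions — the dimension-4 slices -/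

/-- PR_all^{≤ m} over `k` in ambient dimension `≤ 4`. (Cutkosky2009, Thm. 1.3) -/
def UpToDimFour (k : Type) [Field k] (m : ℕ) : Prop :=
  ∀ (Y : Scheme.{0}) (g : Y ⟶ Spec (.of k)), IsSeparated g → LocallyOfFiniteType g → QuasiCompact g →
    IsIntegral Y → Scheme.IsRegular Y → topologicalKrullDim Y ≤ 4 →
    ∀ I : Y.IdealSheafData, I ≠ ⊥ → (∀ y : Y, idealOrder I y ≤ m) →
      ∀ (Γ : Scheme.{0}) (b : Γ ⟶ Y), IsBlowup b I → Scheme.HasResolution Γ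

/-- The dimension-4 TAME atom (`r < p`; KNOWN-MOD-PORT = the cell's tame pocket in all-ideal format).
(Wlodarczyk2005, §4 Step 1) -/
def MaxOrderStepTameDimFour (r : ℕ) : Prop :=
  ∀ p : ℕ, p.Prime → ∀ (k : Type) [Field k] [CharP k p], r < p → UpToDimFour k (r - 1) → UpToDimFour k r

/-- The dimension-4 WILD atom (`p ≤ r`) — the located residual of the node.
(CossartPiltant2019, Introduction) -/
def MaxOrderStepWildDimFour (r : ℕ) : Prop :=
  ∀ p : ℕ, p.Prime → ∀ (k : Type) [Field k] [CharP k p], p ≤ r → UpToDimFour k (r - 1) → UpToDimFour k r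

/-! ## Part B notions — max-order marked ideals on regular threefolds -/

/-- **MaxOrd₃^E(c)**: for a regular `S/k` of dimension `≤ 3` (separated, of finite type), an ideal sheaf `J` with
`ord_y J ≤ c` everywhere and an snc boundary `E`, the marked ideal `(J, E, c)` admits a resolution in the sense of
BGMW Def. 3.1.3 (Cutkosky 2009 Thm. 5.1 is the case `k = k̄`, `E = ∅`; ports: imposed snc boundary, arbitrary field).
(Cutkosky2009, Thm. 5.1) (BierstoneGrigorievMilmanWlodarczyk2011, Def. 3.1.3) -/
def MaxOrderThreefoldResolutionAt (c : ℕ) : Prop :=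
  ∀ p : ℕ, p.Prime → ∀ (k : Type) [Field k] [CharP k p] (S : Scheme.{0}) (g : S ⟶ Spec (.of k)),
    IsSeparated g → LocallyOfFiniteType g → QuasiCompact g → Scheme.IsRegular S →
    topologicalKrullDim S ≤ 3 →
    ∀ (J : S.IdealSheafData) (E : List S.IdealSheafData), (∀ y : S, idealOrder J y ≤ c) → HasSNC E →
      ∃ t : CentreSeq S, t.IsResolutionOf (⟨J, E, c⟩ : MarkedIdeal S)

/-- **MaxOrd₃^∅(c)**: the boundary-free slice (= the literal restriction of X1(c) to max-order ideals).
(Cutkosky2009, Thm. 5.1) -/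
def MaxOrderThreefoldResolutionEmptyAt (c : ℕ) : Prop :=
  ∀ p : ℕ, p.Prime → ∀ (k : Type) [Field k] [CharP k p] (S : Scheme.{0}) (g : S ⟶ Spec (.of k)),
    IsSeparated g → LocallyOfFiniteType g → QuasiCompact g → Scheme.IsRegular S →
    topologicalKrullDim S ≤ 3 →
    ∀ J : S.IdealSheafData, (∀ y : S, idealOrder J y ≤ c) →
      ∃ t : CentreSeq S, t.IsResolutionOf (⟨J, [], c⟩ : MarkedIdeal S)

/-! ## Definitional kernels (so that the module is not inert) -/

/-- The atom is EXACTLY the conjunction of its tame and wild slices (by cases `r < p` / `p ≤ r`). [folklore] -/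
theorem maxOrderStep_iff (r : ℕ) : MaxOrderStep r ↔ MaxOrderStepTame r ∧ MaxOrderStepWild r := by
  constructor
  · intro h
    exact ⟨fun p hp k _ _ _ => h p hp k, fun p hp k _ _ _ => h p hp k⟩
  · rintro ⟨hT, hW⟩ p hp k _ _
    rcases Nat.lt_or_ge r p with hrp | hpr
    · exact hT p hp k hrp
    · exact hW p hp k hpr

/-- Monotonicity of the rungs in the bound. [folklore] -/
theorem upTo_mono {k : Type} [Field k] {m m' : ℕ} (hmm' : m ≤ m') (h : UpTo k m') : UpTo k m :=
  fun Y g hg₁ hg₂ hg₃ hY hYreg I hI hord Γ b hb =>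
    h Y g hg₁ hg₂ hg₃ hY hYreg I hI (fun y => (hord y).trans (by exact_mod_cast hmm')) Γ b hb

/-- Restriction of the all-dimensional rung to dimension `≤ 4`. [folklore] -/
theorem upToDimFour_of_upTo {k : Type} [Field k] {m : ℕ} (h : UpTo k m) : UpToDimFour k m :=
  fun Y g hg₁ hg₂ hg₃ hY hYreg _ I hI hord Γ b hb => h Y g hg₁ hg₂ hg₃ hY hYreg I hI hord Γ b hb

/-- The boundary version contains the boundary-free one (`E = []` has snc on a regular scheme, tree
`hasSNC_nil_of_isRegular`). [folklore] -/
theorem maxOrderEmpty_of_bdry (c : ℕ) (h : MaxOrderThreefoldResolutionAt c) :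
    MaxOrderThreefoldResolutionEmptyAt c := by
  intro p hp k _ _ S g h₁ h₂ h₃ hS hdim J hord
  haveI := h₂
  haveI : IsLocallyNoetherian S := LocallyOfFiniteType.isLocallyNoetherian g
  exact h p hp k S g h₁ h₂ h₃ hS hdim J [] hord (hasSNC_nil_of_isRegular hS)

end Summit.ResolutionOfSingularities.ResolutionOfSingularities.Theorems.MaxOrderAtomClasses
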